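import Literature.AlgebraicGeometry.Resolution.WeightedCentreTruncatedExponential
import Literature.AlgebraicGeometry.Resolution.WeightedCentreGradedIsotropy
import Literature.AlgebraicGeometry.Resolution.WeightedCentreDerivationLayers
import Literature.AlgebraicGeometry.Resolution.WeightedCentreConstantField
import Literature.AlgebraicGeometry.Resolution.WeightedCentreFrobeniusPin
import HarnessLib

/-!
# Tailed light flows: the substitution `Φ(T) = Σ_{b<p} T^b 𝔇^b/b! + T^p q` and the typed object (O3) of engine 1's `W(f)` toy model
# (RE-DERIVATION-eng1-g44 §3.1 (O3), target T106 — an instrument and a typed TARGET, NOT a resolution theorem)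

RE-DERIVATION-eng1-g44 §3.1 (O3) / CARVER-NOTES-eng1-g44 §1 "T106 … GO with the FINAL structure": a TAILED LIGHT FLOW of unit `θ > 0` on a
menu `(M, h)` (slots `ε_i`, rational weights `w i` in `ρ₁`-units: LIGHT `w < p`, HEAVY `p ≤ w ≤ p + 1`, `V` `w > p + 1`; `h ∈ k[ε_M]`) is
a pair `(𝔇, q) ≠ (0, 0)` with
* (tf1) `𝔇` a `k`-derivation of `k[ε_M]`, triangular of degree `−θ` (`𝔇(ε_i)` homogeneous of weight `w i − θ`), `𝔇(ε_i) ∈ k[light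
  variables lighter than ε_i]` (constants allowed), `𝔇 = 0` on `ε_V`;
* (tf3) a TAIL `q = (q_i)` on the heavy slots only, `q_i ∈ k[light variables]` homogeneous of weight `w i − p·θ` (constants allowed);
* (tf4) the `k[T]`-algebra SUBSTITUTION `Φ(T)` of `k[T][ε_M]`, `Φ(T)(ε_i) := Σ_{0 ≤ b < p} T^b 𝔇^b(ε_i)/b! + T^p q_i` (`T` a FREE
  variable), satisfies `h(Φ(T)ε) = h(ε)`.
NO nilpotency condition, no group law: `Φ(T)` is substituted once and never composed or inverted (CARVER-NOTES-eng1-g44 §1; C523 (A)).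

This file TYPES the object and its substitution, hypothesis-free:
* `substC 𝔇 p u q : k[ε] →ₐ[k] k[ε][T]` (`T = Polynomial.X`; `u b` plays `1/b!`, cf. `factorialInvSeq` / `hu : b! · u b = 1 (b < p)` of
  `WeightedCentreTruncatedExponential`; the `b < p` part IS `sigmaExp 𝔇 p u`) and `subst` (its extension to `k[ε][T]` fixing `T`); the
  `T`-coefficients on a slot (`coeff_substC_X`: `ε_i`, `𝔇 ε_i`, …, `q_i`, `0`); `Φ(T)(ε_i) = ε_i` on data-free slots (`substC_X_eq_C`);
* **gradedness** (`isGradedHom_subst`): if `𝔇` lowers weights by `θ` on generators and `q_i` weighs `w i − p·θ`, then `Φ(T)` is graded for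
  `wt T = θ` (`IsGradedHom w θ`, the tree's notion with `T` in the rôle of `σ`); `Derivation.lowers_of_X`: generatorwise degree `−θ` ⇒ `𝔇`
  lowers the weight of every homogeneous polynomial by `θ` (from `WeightedCentreDerivationLayers`);
* **light supports propagate** (`vars_iterate_X`): if every `𝔇(ε_i)` involves only variables `j` with `w j < c ∧ w j < w i`, so does every
  `𝔇^n(ε_i)`, `n ≥ 1` (chain rule `𝔇 = Σ ∂_i(·) 𝔇(ε_i)` of `WeightedCentreConstantField`);
* the Prop-valued structure **`IsTailedLightFlow p u w θ h 𝔇 q`** = (tf1) ∧ (tf3) ∧ (tf4) ∧ `θ > 0` ∧ `(𝔇, q) ≠ 0`, its first consequences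
  (`Φ(T)` graded, `= id` on `ε_V`, linear `T`-coefficient `= 𝔇`), and the typed TARGET **`NoTailedLightFlow p u w h`** : `∀ θ 𝔇 q, ¬
  IsTailedLightFlow …` — the conclusion of THEOREM 𝔉′ of RE-DERIVATION-eng1-g44 §3.3 for the menu `(ι, w, h)`.  THEOREM 𝔉′ itself ("no
  (P)-menu of the setting carries a tailed light flow"; proof (H′) → (L0′) → (L1′) by induction on the number of light classes, USING the
  pinning hypothesis (P) through the translation criterion — `WeightedCentreKillCoordinates` is its step (L0′) = L7) is NOT proved here:
  this file only fixes the statement it is about.  A `def … : Prop`, not an assertion.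

Instrument / typed target for the toy model (cell `pub-rosobs`, carver lane gen 64; AI-written Lean, AI review weaker than expert review);
NOT a statement about the invariant of [AbramovichTemkinWlodarczyk2024], NOT a resolution theorem.  Truncated exponentials of derivations
/ higher derivations [Matsumura1987, §27 (pp. 207–209), §25]; gradings as in [AbramovichTemkinWlodarczyk2024, Thm. 5.3.1 (2)–(3) (p.
1578)].  Statements ours.
-/

namespace Literature.AlgebraicGeometry.Resolution.WeightedBlowup

open Polynomial
open scoped Nat

namespace TailedLightFlow

section Subst

variable {k : Type*} [CommRing k] {ι : Type*} (D : Derivation k (MvPolynomial ι k) (MvPolynomial ι k)) (p : ℕ) (u : ℕ → k)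
  (q : ι → MvPolynomial ι k)

/-- `Φ(T)` on `k[ε]`: `ε_i ↦ Σ_{b<p} u_b 𝔇^b(ε_i) T^b + q_i T^p` (construction; (tf4) of RE-DERIVATION-eng1-g44 §3.1 (O3)).
[cite: Matsumura1987, §27 (pp. 207–209)] -/
noncomputable def substC : MvPolynomial ι k →ₐ[k] (MvPolynomial ι k)[X] :=
  MvPolynomial.aeval fun i => sigmaExp D p u (MvPolynomial.X i) + C (q i) * X ^ p

/-- `Φ(T)` on a slot (bookkeeping). [cite: Matsumura1987, §27 (pp. 207–209)] -/
theorem substC_X (i : ι) : substC D p u q (MvPolynomial.X i) = sigmaExp D p u (MvPolynomial.X i) + C (q i) * X ^ p := by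
  rw [substC, MvPolynomial.aeval_X]

/-- `Φ(T)` fixes the scalars (bookkeeping). [cite: Matsumura1987, §27 (pp. 207–209)] -/
theorem substC_C (c : k) : substC D p u q (MvPolynomial.C c) = C (MvPolynomial.C c) := by
  rw [substC, MvPolynomial.algHom_C, Polynomial.algebraMap_apply, MvPolynomial.algebraMap_eq]

/-- `Φ(T)` as a substitution of `k[ε][T]` fixing `T` (construction). [cite: Matsumura1987, §27 (pp. 207–209)] -/
noncomputable def subst : (MvPolynomial ι k)[X] →+* (MvPolynomial ι k)[X] :=
  eval₂RingHom (substC D p u q).toRingHom X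

/-- `Φ(T) T = T` (bookkeeping). [cite: Matsumura1987, §27 (pp. 207–209)] -/
@[simp] theorem subst_X : subst D p u q X = X := by
  rw [subst, coe_eval₂RingHom, eval₂_X]

/-- `Φ(T) (C g) = substC g` (bookkeeping). [cite: Matsumura1987, §27 (pp. 207–209)] -/
theorem subst_C (g : MvPolynomial ι k) : subst D p u q (C g) = substC D p u q g := by
  rw [subst, coe_eval₂RingHom, eval₂_C]; rfl

/-- `Φ(T)` fixes the scalars of `k[ε][T]` (bookkeeping). [cite: Matsumura1987, §27 (pp. 207–209)] -/
theorem subst_C_C (c : k) : subst D p u q (C (MvPolynomial.C c)) = C (MvPolynomial.C c) := by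
  rw [subst_C, substC_C]

/-- **The `T`-coefficients of `Φ(T)(ε_i)`**: `u_n 𝔇^n(ε_i)` for `n < p`, the tail `q_i` at `n = p`, `0` above (derived here).
[cite: Matsumura1987, §27 (pp. 207–209)] -/
theorem coeff_substC_X (i : ι) (n : ℕ) :
    (substC D p u q (MvPolynomial.X i)).coeff n = (if n < p then u n • D^[n] (MvPolynomial.X i) else 0) + if n = p then q i else 0 := by
  rw [substC_X, coeff_add, coeff_sigmaExp_X, coeff_C_mul_X_pow]

/-- `Φ(T)(ε_i) ≡ ε_i (mod T)` when `u_0 = 1` (derived here). [cite: Matsumura1987, §27 (pp. 207–209)] -/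
theorem coeff_substC_X_zero (hu : ∀ n < p, ((n ! : ℕ) : k) * u n = 1) (hp : 0 < p) (i : ι) :
    (substC D p u q (MvPolynomial.X i)).coeff 0 = MvPolynomial.X i := by
  have h0 : u 0 = 1 := by simpa using hu 0 hp
  rw [coeff_substC_X, if_pos hp, if_neg (Nat.pos_iff_ne_zero.mp hp).symm, add_zero, h0, one_smul, Function.iterate_zero_apply]

/-- The linear `T`-coefficient of `Φ(T)(ε_i)` is `𝔇(ε_i)` when `u_1 = 1`, `p > 1` (derived here). [cite: Matsumura1987, §27 (pp. 207–209)] -/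
theorem coeff_substC_X_one (hu : ∀ n < p, ((n ! : ℕ) : k) * u n = 1) (hp : 1 < p) (i : ι) :
    (substC D p u q (MvPolynomial.X i)).coeff 1 = D (MvPolynomial.X i) := by
  have h1 : u 1 = 1 := by simpa using hu 1 hp
  rw [coeff_substC_X, if_pos hp, if_neg (ne_of_gt hp).symm, add_zero, h1, one_smul, Function.iterate_one]

/-- The `T^p`-coefficient of `Φ(T)(ε_i)` is the tail `q_i` (derived here). [cite: Matsumura1987, §27 (pp. 207–209)] -/
theorem coeff_substC_X_self (i : ι) : (substC D p u q (MvPolynomial.X i)).coeff p = q i := by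
  rw [coeff_substC_X, if_neg (lt_irrefl p), zero_add, if_pos rfl]

/-- If `𝔇(ε_i) = 0` then `𝔇^n(ε_i) = 0` for `n ≥ 1` (bookkeeping). [cite: Matsumura1987, §25] -/
theorem iterate_X_eq_zero {i : ι} (hD : D (MvPolynomial.X i) = 0) {n : ℕ} (hn : 0 < n) : D^[n] (MvPolynomial.X i) = 0 := by
  obtain ⟨m, rfl⟩ := Nat.exists_eq_add_of_le hn
  induction m with
  | zero => rw [add_zero, Function.iterate_one, hD]
  | succ m ih => rw [← add_assoc, Function.iterate_succ_apply', ih (Nat.le_add_right 1 m), map_zero]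

/-- **`Φ(T)(ε_i) = ε_i` on a data-free slot** (`𝔇(ε_i) = 0`, `q_i = 0`; e.g. the slots of `V`) when `u_0 = 1` (derived here).
[cite: Matsumura1987, §27 (pp. 207–209)] -/
theorem substC_X_eq_C (hu : ∀ n < p, ((n ! : ℕ) : k) * u n = 1) (hp : 0 < p) {i : ι} (hD : D (MvPolynomial.X i) = 0) (hq : q i = 0) :
    substC D p u q (MvPolynomial.X i) = C (MvPolynomial.X i) := by
  ext n
  rw [coeff_C]
  rcases Nat.eq_zero_or_pos n with rfl | hn
  · rw [if_pos rfl, coeff_substC_X_zero D p u q hu hp]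
  · rw [if_neg hn.ne', coeff_substC_X, iterate_X_eq_zero D hD hn, smul_zero, hq]
    simp

end Subst

/-! ## Gradedness -/

section Graded

variable {k : Type*} [CommRing k] {ι : Type*} (D : Derivation k (MvPolynomial ι k) (MvPolynomial ι k)) {M : Type*} [AddCommGroup M]
  {w : ι → M} {θ : M}

/-- **Generatorwise degree `−θ` ⇒ `𝔇` lowers the weight of every homogeneous polynomial by `θ`** (derived here, from the component
shift of `WeightedCentreDerivationLayers`). [cite: AbramovichTemkinWlodarczyk2024, Thm. 5.3.1 (2)–(3) (p. 1578)] -/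
theorem lowers_of_X (hDX : ∀ i, MvPolynomial.IsWeightedHomogeneous w (D (MvPolynomial.X i)) (w i - θ)) {a : MvPolynomial ι k} {m : M}
    (ha : MvPolynomial.IsWeightedHomogeneous w a m) : MvPolynomial.IsWeightedHomogeneous w (D a) (m - θ) := by
  have hf : DerivationLayers.IsGradedCoeff w θ (fun i => D (MvPolynomial.X i)) := fun i _ => ⟨w i - θ, hDX i, sub_add_cancel _ _⟩
  have h := DerivationLayers.weightedHomogeneousComponent_mkDerivation hf a (m - θ)
  rw [sub_add_cancel, ha.weightedHomogeneousComponent_same, ← DerivationLayers.derivation_eq_mkDerivation D] at h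
  rw [← h]
  exact MvPolynomial.weightedHomogeneousComponent_isWeightedHomogeneous _ _

/-- `𝔇^n(ε_i)` weighs `w i − n·θ` (bookkeeping). [cite: AbramovichTemkinWlodarczyk2024, Thm. 5.3.1 (2)–(3) (p. 1578)] -/
theorem isWeightedHomogeneous_iterate_X (hDX : ∀ i, MvPolynomial.IsWeightedHomogeneous w (D (MvPolynomial.X i)) (w i - θ)) (i : ι) :
    ∀ n : ℕ, MvPolynomial.IsWeightedHomogeneous w (D^[n] (MvPolynomial.X i)) (w i - n • θ)
  | 0 => by simpa using MvPolynomial.isWeightedHomogeneous_X k w i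
  | n + 1 => by
    rw [Function.iterate_succ_apply', succ_nsmul, ← sub_sub]
    exact lowers_of_X D hDX (isWeightedHomogeneous_iterate_X hDX i n)

variable (p : ℕ) (u : ℕ → k) {q : ι → MvPolynomial ι k}

/-- **`Φ(T)(ε_i)` has total weight `w i` for `wt T = θ`** when `𝔇` has degree `−θ` on generators and `q_i` weighs `w i − p·θ` (derived here).
[cite: AbramovichTemkinWlodarczyk2024, Thm. 5.3.1 (2)–(3) (p. 1578)] -/
theorem isTW_substC_X (hDX : ∀ i, MvPolynomial.IsWeightedHomogeneous w (D (MvPolynomial.X i)) (w i - θ)) {i : ι}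
    (hq : MvPolynomial.IsWeightedHomogeneous w (q i) (w i - p • θ)) : IsTW w θ (w i) (substC D p u q (MvPolynomial.X i)) := by
  intro s
  rw [coeff_substC_X]
  refine MvPolynomial.IsWeightedHomogeneous.add ?_ ?_
  · split_ifs
    · exact (MvPolynomial.weightedHomogeneousSubmodule k w _).smul_mem (u s) (isWeightedHomogeneous_iterate_X D hDX i s)
    · exact MvPolynomial.isWeightedHomogeneous_zero k w _
  · split_ifs with h
    · rw [h]; exact hq
    · exact MvPolynomial.isWeightedHomogeneous_zero k w _

/-- **`Φ(T)` is GRADED for `wt T = θ`** (derived here): the tree's `IsGradedHom w θ` with `T` in the rôle of `σ`.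
[cite: AbramovichTemkinWlodarczyk2024, Thm. 5.3.1 (2)–(3) (p. 1578)] -/
theorem isGradedHom_subst (hDX : ∀ i, MvPolynomial.IsWeightedHomogeneous w (D (MvPolynomial.X i)) (w i - θ))
    (hq : ∀ i, MvPolynomial.IsWeightedHomogeneous w (q i) (w i - p • θ)) : IsGradedHom w θ (subst D p u q) where
  map_C_C c := subst_C_C D p u q c
  isTW_X := by rw [subst_X]; exact isTW_X
  isTW_CX i := by rw [subst_C]; exact isTW_substC_X D p u hDX (hq i)

end Graded

/-! ## Supports: light variables propagate through `𝔇^n` -/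

section Vars

variable {k : Type*} [CommRing k] {ι : Type*} [Fintype ι] [DecidableEq ι] (D : Derivation k (MvPolynomial ι k) (MvPolynomial ι k))

/-- **Chain-rule support bound** (derived here): a variable of `𝔇 f` is a variable of `f` or a variable of `𝔇(ε_i)` for some variable `ε_i`
of `f` (`𝔇 f = Σ_i ∂_i f · 𝔇(ε_i)`). [cite: Matsumura1987, §25] -/
theorem mem_vars_apply (f : MvPolynomial ι k) {j : ι} (hj : j ∈ (D f).vars) :
    j ∈ f.vars ∨ ∃ i ∈ f.vars, j ∈ (D (MvPolynomial.X i)).vars := by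
  rw [derivation_apply_eq_sum_pderiv_mul] at hj
  obtain ⟨i, -, hi⟩ := Finset.mem_biUnion.mp (MvPolynomial.vars_sum_subset _ _ hj)
  by_cases hif : i ∈ f.vars
  · rcases Finset.mem_union.mp (MvPolynomial.vars_mul _ _ hi) with h | h
    · exact Or.inl (by_contra fun hjf => FrobeniusPin.notMem_vars_pderiv i hjf h)
    · exact Or.inr ⟨i, hif, h⟩
  · rw [MvPolynomial.pderiv_eq_zero_of_notMem_vars hif, zero_mul, MvPolynomial.vars_0] at hi
    exact absurd hi (Finset.notMem_empty j)

/-- **Light supports propagate** (derived here): if every `𝔇(ε_i)` involves only variables `j` with `w j < c` and `w j < w i`, then so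
does every `𝔇^n(ε_i)`, `n ≥ 1` ((tf1): "`𝔇^b(x) ∈ k[light variables lighter than x]`"). [cite: Matsumura1987, §25] -/
theorem vars_iterate_X {N : Type*} [Preorder N] (w : ι → N) (c : N)
    (hv : ∀ i, ∀ j ∈ (D (MvPolynomial.X i)).vars, w j < c ∧ w j < w i) (i : ι) {n : ℕ} (hn : 0 < n) :
    ∀ j ∈ (D^[n] (MvPolynomial.X i)).vars, w j < c ∧ w j < w i := by
  obtain ⟨m, rfl⟩ := Nat.exists_eq_add_of_le hn
  induction m with
  | zero => rw [add_zero, Function.iterate_one]; exact hv i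
  | succ m ih =>
    intro j hj
    rw [← add_assoc, Function.iterate_succ_apply'] at hj
    rcases mem_vars_apply D _ hj with h | ⟨l, hl, hjl⟩
    · exact ih (Nat.le_add_right 1 m) j h
    · have h1 := ih (Nat.le_add_right 1 m) l hl
      exact ⟨(hv l j hjl).1, lt_trans (hv l j hjl).2 h1.2⟩

end Vars

/-! ## The typed object (O3) and the typed target of THEOREM 𝔉′ -/

section Object

variable {k : Type*} [CommRing k] {ι : Type*}

/-- **TAILED LIGHT FLOW of unit `θ` on the menu `(ι, w, h)`** (RE-DERIVATION-eng1-g44 §3.1 (O3), final form of CARVER-NOTES-eng1-g44 §1: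
fields (tf1), (tf3), (tf4) only — NO nilpotency field; `(𝔇, q) ≠ 0`; weights in `ρ₁`-units: light `< p`, heavy `[p, p+1]`, `V` `> p+1`;
`u b` plays `1/b!`).  A definition (ours), not an assertion. [cite: Matsumura1987, §27 (pp. 207–209)]
[cite: AbramovichTemkinWlodarczyk2024, Thm. 5.3.1 (2)–(3) (p. 1578)] -/
structure IsTailedLightFlow (p : ℕ) (u : ℕ → k) (w : ι → ℚ) (θ : ℚ) (h : MvPolynomial ι k)
    (D : Derivation k (MvPolynomial ι k) (MvPolynomial ι k)) (q : ι → MvPolynomial ι k) : Prop where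
  /-- the unit is positive -/
  pos : 0 < θ
  /-- (tf1) `𝔇` is triangular of degree `−θ` -/
  wt_D : ∀ i, MvPolynomial.IsWeightedHomogeneous w (D (MvPolynomial.X i)) (w i - θ)
  /-- (tf1) `𝔇(ε_i) ∈ k[light variables lighter than ε_i]` -/
  vars_D : ∀ i, ∀ j ∈ (D (MvPolynomial.X i)).vars, w j < p ∧ w j < w i
  /-- (tf1) `𝔇 = 0` on `ε_V` -/
  D_X_eq_zero : ∀ i, (p : ℚ) + 1 < w i → D (MvPolynomial.X i) = 0
  /-- (tf3) `q_i` weighs `w i − p·θ` -/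
  wt_q : ∀ i, MvPolynomial.IsWeightedHomogeneous w (q i) (w i - p • θ)
  /-- (tf3) `q_i ∈ k[light variables]` -/
  vars_q : ∀ i, ∀ j ∈ (q i).vars, w j < p
  /-- (tf3) tails on heavy slots only -/
  q_eq_zero : ∀ i, w i < p ∨ (p : ℚ) + 1 < w i → q i = 0
  /-- (tf4) `h(Φ(T)ε) = h`, `T` free -/
  fix : substC D p u q h = C h
  /-- `(𝔇, q) ≠ (0, 0)` -/
  ne_zero : (∃ i, D (MvPolynomial.X i) ≠ 0) ∨ ∃ i, q i ≠ 0

/-- **The typed TARGET of THEOREM 𝔉′** for the menu `(ι, w, h)`: it carries no tailed light flow of any unit (a `Prop`, ours; THEOREM 𝔉′ of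
RE-DERIVATION-eng1-g44 §3.3 asserts it for every (P)-menu of the setting — NOT proved in this file). [cite: Matsumura1987, §27 (pp. 207–209)] -/
def NoTailedLightFlow (p : ℕ) (u : ℕ → k) (w : ι → ℚ) (h : MvPolynomial ι k) : Prop :=
  ∀ (θ : ℚ) (D : Derivation k (MvPolynomial ι k) (MvPolynomial ι k)) (q : ι → MvPolynomial ι k), ¬ IsTailedLightFlow p u w θ h D q

namespace IsTailedLightFlow

variable {p : ℕ} {u : ℕ → k} {w : ι → ℚ} {θ : ℚ} {h : MvPolynomial ι k} {D : Derivation k (MvPolynomial ι k) (MvPolynomial ι k)}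
  {q : ι → MvPolynomial ι k}

/-- `Φ(T)` of a tailed light flow is graded for `wt T = θ` (derived here). [cite: AbramovichTemkinWlodarczyk2024, Thm. 5.3.1 (2)–(3) (p. 1578)] -/
theorem isGradedHom (F : IsTailedLightFlow p u w θ h D q) : IsGradedHom w θ (subst D p u q) :=
  isGradedHom_subst D p u F.wt_D F.wt_q

/-- `Φ(T) = id` on `ε_V` (derived here; (tf1) + (tf3) + `u_0 = 1`). [cite: Matsumura1987, §27 (pp. 207–209)] -/
theorem substC_X_of_V (F : IsTailedLightFlow p u w θ h D q) (hu : ∀ n < p, ((n ! : ℕ) : k) * u n = 1) (hp : 0 < p) {i : ι}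
    (hi : (p : ℚ) + 1 < w i) : substC D p u q (MvPolynomial.X i) = C (MvPolynomial.X i) :=
  substC_X_eq_C D p u q hu hp (F.D_X_eq_zero i hi) (F.q_eq_zero i (Or.inr hi))

/-- No tail on a light slot (bookkeeping). [cite: Matsumura1987, §27 (pp. 207–209)] -/
theorem q_eq_zero_of_light (F : IsTailedLightFlow p u w θ h D q) {i : ι} (hi : w i < p) : q i = 0 := F.q_eq_zero i (Or.inl hi)

/-- Every `𝔇^n(ε_i)` (`n ≥ 1`) of a tailed light flow involves only light variables lighter than `ε_i` (derived here).
[cite: Matsumura1987, §25] -/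
theorem vars_iterate [Fintype ι] [DecidableEq ι] (F : IsTailedLightFlow p u w θ h D q) (i : ι) {n : ℕ} (hn : 0 < n) :
    ∀ j ∈ (D^[n] (MvPolynomial.X i)).vars, w j < p ∧ w j < w i :=
  vars_iterate_X D w (p : ℚ) F.vars_D i hn

/-- The `T`-coefficients of `Φ(T)(ε_i)` of positive order involve only light variables lighter than `ε_i` (derived here; the shape
hypothesis of `WeightedCentreKillCoordinates` for step (L0′)). [cite: Matsumura1987, §25] -/
theorem vars_coeff_substC_X [Fintype ι] [DecidableEq ι] (F : IsTailedLightFlow p u w θ h D q) (i : ι) {n : ℕ} (hn : 0 < n) :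
    ∀ j ∈ ((substC D p u q (MvPolynomial.X i)).coeff n).vars, w j < p ∧ w j < w i := by
  intro j hj
  rw [coeff_substC_X] at hj
  rcases Finset.mem_union.mp (MvPolynomial.vars_add_subset _ _ hj) with h1 | h1
  · split_ifs at h1 with hlt
    · rw [MvPolynomial.smul_eq_C_mul] at h1
      rcases Finset.mem_union.mp (MvPolynomial.vars_mul _ _ h1) with h2 | h2
      · rw [MvPolynomial.vars_C] at h2; exact absurd h2 (Finset.notMem_empty j)
      · exact F.vars_iterate i hn j h2
    · rw [MvPolynomial.vars_0] at h1; exact absurd h1 (Finset.notMem_empty j)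
  · split_ifs at h1 with heq
    · refine ⟨F.vars_q i j h1, ?_⟩
      by_contra hle
      have hq0 : q i = 0 := by
        rcases lt_or_ge (w i) (p : ℚ) with hlt | hge
        · exact F.q_eq_zero_of_light hlt
        · exact absurd (lt_of_lt_of_le (F.vars_q i j h1) hge) hle
      rw [hq0, MvPolynomial.vars_0] at h1
      exact absurd h1 (Finset.notMem_empty j)
    · rw [MvPolynomial.vars_0] at h1; exact absurd h1 (Finset.notMem_empty j)

end IsTailedLightFlow

end Object

end TailedLightFlow

end Literature.AlgebraicGeometry.Resolution.WeightedBlowup
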